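import Literature.Analysis.FluidPDE.RusinSverakSingularTime
import Literature.Analysis.FluidPDE.RusinSverakSingularPoint
import HarnessLib

/-!
# `N′` (a finite maximal time forces a singularity at `t = T_max(u₀)`) from Kato's local existence, `L^∞` continuation and the far-field bound
(Rusin–Šverák 2011, §4 pp. 6–7; Lemarié-Rieusset, *The Navier–Stokes problem in the 21st century*, 2nd ed., Thm. 15.1 (C))

Analysis/FluidPDE proof file for the named fact
`Literature.Analysis.FluidPDE.rusin_sverak_singularity_at_katoMaximalTime` (**N′**,
`RusinSverakSingularTime.lean`; Rusin–Šverák, J. Funct. Anal. 260 (2011) 879–891 =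
arXiv:0911.0500, §4 p. 6, the sketch after Thm. 4.1: "the only reason for `T_max(u₀) < ∞` can be
a finite time singularity"): for a weakly divergence-free `u₀ ∈ L³(ℝ³)` (represented in
`Ḣ^{1/2}`) with `T_max(u₀) < ∞`, every Kato solution on `[0, T_max(u₀))` is essentially
unbounded on every backward parabolic cylinder `Q_r(T_max, x_*)` at some `x_* ∈ ℝ³`.

The printed sketch (arXiv p. 6) runs: (i)–(ii) the Leray solution `u = a + v` (Calderón
splitting) coincides with the mild solution on `[0, T)`, `T = T_max(u₀)` (Thm. 4.1), and its
energy and pressure estimates, uniform up to `T`, put every cylinder `Q_{(x₀,T),r}`,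
`r = √(T/2)`, `|x₀| > R`, under the ε-regularity criterion Prop. 2.1, so `u` is bounded near
`(x₀, T)` for `|x₀| > R`; (iii) "if `u` does not develop a singularity at time `T` in the ball
`B_R`, it means that `u` and `∇u` will be bounded in `(t₁,T)`"; (iv) then
`u ⊗ u ∈ L²_t Ḣ^{1/2}_x`, the Stokes energy estimate gives `u ∈ L⁴_t Ḣ¹_x(ℝ³ × (0,T))`, "which
means that `T` was not the maximal time of existence of the mild solution, a contradiction"
(§3 (3.14)). `RusinSverakSingularPoint.lean` vendors (i)–(ii) and (iv) over the tree's Kato class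
as the named facts `IsKatoSolutionOn.farField_bound` (boundedness on `(T - δ, T) × {|x| > R}`)
and `IsKatoSolutionOn.continuation_of_bounded` (a Kato solution bounded on a strip
`(T - δ, T) × ℝ³` continues to some `[0, T')`, `T' > T`), proves the compactness step (iii)
(`exists_pos_eLpNorm_lt_top_of_forall_exists_cylinder`) and derives `N`
(`rusin_sverak_singular_point_of_blowup`, anonymous lifespan) for the *glued* maximal solution.

This file proves **`N′` itself — for every Kato solution on `[0, T_max)` — from the same three
inputs**, with no appeal to uniqueness: `T_max(u₀) > 0` by `kato_local` (`katoMaximalTime_pos`);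
if every `x` had a bounded cylinder `Q_{r_x}(T_max, x)`, the far-field bound and compactness would
bound `u` on a strip `(T_max - δ, T_max) × ℝ³`, and the continuation would produce a Kato solution
on `[0, T')`, `T' > T_max`, contradicting maximality (`not_isKatoSolutionOn_of_katoMaximalTime_lt`):

* `rusin_sverak_singularity_at_katoMaximalTime_of_continuation :
    kato_local → IsKatoSolutionOn.continuation_of_bounded → IsKatoSolutionOn.farField_bound → N′`;
* Cor. 4.3 (both clauses) from `kato_local`, the two facts and `C = rusin_sverak_weak_limit_of_singular_points`
  (`rusin_sverak_minimal_data_compact_of_continuation`, `rusin_sverak_minimal_blowup_of_continuation`;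
  `kato_unique` is the tree's theorem `kato_unique_holds`, `KatoL3Uniqueness.lean`).

State of the DAG below `rusin_sverak_minimal_data_compact` (Cor. 4.3) after this file: proved
modulo `kato_local` (Kato 1984, Thm. 1), `IsKatoSolutionOn.continuation_of_bounded`,
`IsKatoSolutionOn.farField_bound` and `C` (Cor. 4.2); `N′` and `N` are no longer leaves. The
dependence on `kato_local` is genuine: for a datum with `T_max(u₀) = 0` the conclusion of `N′`
would fail (the cylinders `Q_r(0, x_*)` lie at negative times, where a Kato solution on `[0, 0)`
is unconstrained), so every proof of `N′` contains local existence for its data.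

## Mathlib / tree search

Tree: `rusin_sverak_singularity_at_katoMaximalTime` and its corollaries
(`RusinSverakSingularTime.lean`); `IsKatoSolutionOn.continuation_of_bounded`,
`IsKatoSolutionOn.farField_bound`, `exists_pos_eLpNorm_lt_top_of_forall_exists_cylinder`
(`RusinSverakSingularPoint.lean`); `katoMaximalTime_pos`, `not_isKatoSolutionOn_of_katoMaximalTime_lt`
(`KatoMaximalTime.lean`); `kato_unique_holds` (`KatoL3Uniqueness.lean`). Mathlib:
`ENNReal.toReal_pos`, `ENNReal.ofReal_toReal`, `ENNReal.ofReal_lt_ofReal_iff`.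

## References

* W. Rusin, V. Šverák, *Minimal initial data for potential Navier–Stokes singularities*,
  J. Funct. Anal. 260 (2011) 879–891 = arXiv:0911.0500, §3 (3.14), §4 pp. 6–7 (the paragraph
  after Thm. 4.1), Cor. 4.3 (p. 8). Bib key `RusinSverak2011`.
* P. G. Lemarié-Rieusset, *The Navier–Stokes problem in the 21st century*, 2nd ed., CRC Press,
  §15.2 Thm. 15.1 (C) and its proof. Bib key `Lemarierieusset2023`.
* T. Kato, Math. Z. 187 (1984) 471–480, Thm. 1 (`kato_local`). Bib key `Kato1984`.
-/

noncomputable section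

open MeasureTheory TopologicalSpace Set Function Filter
open scoped ENNReal

namespace Literature.Analysis.FluidPDE

/-- **`N′` from `kato_local`, `IsKatoSolutionOn.continuation_of_bounded` and
`IsKatoSolutionOn.farField_bound`** (Rusin–Šverák 2011, §4 p. 6, the sketch after Thm. 4.1;
Lemarié-Rieusset, *The Navier–Stokes problem in the 21st century*, 2nd ed., Thm. 15.1 (C) and its
proof): let `u₀ ∈ L³` be weakly divergence free with `T_max(u₀) < ∞` and let `u` be any Kato
solution on `[0, T_max)`. Then `T_max > 0` (`kato_local`, `katoMaximalTime_pos`). If every `x` had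
a backward cylinder `Q_{r_x}(T_max, x)` on which `u` is essentially bounded, then together with
the far-field bound on `(T_max - δ₀, T_max) × {|x| > R}` (`farField_bound`: "for sufficiently
large `R > 0`, the assumptions of Proposition 2.1 are satisfied [...] with `z₀ = (x₀,T)` and
`|x₀| > R`") the compactness of `B̄(0,R)`
(`exists_pos_eLpNorm_lt_top_of_forall_exists_cylinder`: "if `u` does not develop a singularity at
time `T` in the ball `B_R`, it means that `u` [...] will be bounded in `(t₁,T)`") bounds `u` on a
full strip `(T_max - δ, T_max) × ℝ³`, and the `L^∞` continuation (`continuation_of_bounded`: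
"`T` was not the maximal time of existence of the mild solution") yields a Kato solution on
`[0, T')` with `T' > T_max`, contradicting maximality
(`not_isKatoSolutionOn_of_katoMaximalTime_lt`). No uniqueness is used; the `Ḣ^{1/2}`
representation hypothesis of `N′` is not needed (as in Lemarié-Rieusset's `L³` statement).
[cite: RusinSverak2011, §4 pp. 6–7 (paragraph after Thm. 4.1), arXiv:0911.0500] -/
theorem rusin_sverak_singularity_at_katoMaximalTime_of_continuation (hL : kato_local)
    (hB : IsKatoSolutionOn.continuation_of_bounded) (hC : IsKatoSolutionOn.farField_bound) :
    rusin_sverak_singularity_at_katoMaximalTime := by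
  intro u₀ g hu₀ _hg hdiv htop u hu
  have hpos : 0 < katoMaximalTime 1 u₀ := katoMaximalTime_pos hL one_pos hu₀ hdiv
  have hT : 0 < (katoMaximalTime 1 u₀).toReal := ENNReal.toReal_pos hpos.ne' htop.ne
  by_contra hcon
  push Not at hcon
  -- every `x` has a bounded cylinder; far field by `hC`; compactness gives a bounded strip
  obtain ⟨δ₀, hδ₀, R, hfar⟩ := hC one_pos hT hu
  obtain ⟨δ, hδ, hbd⟩ := exists_pos_eLpNorm_lt_top_of_forall_exists_cylinder hδ₀ hfar fun x => by
    obtain ⟨r, hr, hne⟩ := hcon x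
    exact ⟨r, hr, lt_top_iff_ne_top.2 hne⟩
  -- continuation past `T_max`, contradicting maximality
  obtain ⟨T', hTT', v, hv⟩ := hB one_pos hT hδ hu hbd
  refine not_isKatoSolutionOn_of_katoMaximalTime_lt ?_ hv
  rw [← ENNReal.ofReal_toReal htop.ne]
  exact (ENNReal.ofReal_lt_ofReal_iff (hT.trans hTT')).2 hTT'

/-- **Rusin–Šverák, Cor. 4.3, second clause** (`rusin_sverak_minimal_data_compact`: the set of
`Ḣ^{1/2}`-minimal blow-up data is compact modulo scalings and translations) **from `kato_local`,
the `L^∞` continuation, the far-field bound and Cor. 4.2** (`C`):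
`rusin_sverak_minimal_data_compact_of_singularity_at_katoMaximalTime` with `N′` supplied by
`rusin_sverak_singularity_at_katoMaximalTime_of_continuation` and `kato_unique` by the tree's
theorem `kato_unique_holds`. [cite: RusinSverak2011, Cor. 4.3 (arXiv:0911.0500 p. 8)] -/
theorem rusin_sverak_minimal_data_compact_of_continuation (hL : kato_local)
    (hB : IsKatoSolutionOn.continuation_of_bounded) (hC : IsKatoSolutionOn.farField_bound)
    (hW : rusin_sverak_weak_limit_of_singular_points) : rusin_sverak_minimal_data_compact :=
  rusin_sverak_minimal_data_compact_of_singularity_at_katoMaximalTime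
    (rusin_sverak_singularity_at_katoMaximalTime_of_continuation hL hB hC) hW hL kato_unique_holds

/-- **Rusin–Šverák, Cor. 4.3, first clause** (`rusin_sverak_minimal_blowup`, ns.S14: minimal
blow-up data exist when `ρ_max < ∞`) **from `kato_local`, the `L^∞` continuation, the far-field
bound and Cor. 4.2** (`C`): `rusin_sverak_minimal_blowup_of_singularity_at_katoMaximalTime` with
`N′` supplied by `rusin_sverak_singularity_at_katoMaximalTime_of_continuation` and `kato_unique`
by `kato_unique_holds`. [cite: RusinSverak2011, Cor. 4.3 (arXiv:0911.0500 p. 8)] -/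
theorem rusin_sverak_minimal_blowup_of_continuation (hL : kato_local)
    (hB : IsKatoSolutionOn.continuation_of_bounded) (hC : IsKatoSolutionOn.farField_bound)
    (hW : rusin_sverak_weak_limit_of_singular_points) : rusin_sverak_minimal_blowup :=
  rusin_sverak_minimal_blowup_of_singularity_at_katoMaximalTime
    (rusin_sverak_singularity_at_katoMaximalTime_of_continuation hL hB hC) hW hL kato_unique_holds

end Literature.Analysis.FluidPDE
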